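import Mathlib
import Summits.MatrixMultiplication.MatrixMultiplication.Theorems.ThinBlockAlphaThinPackingsOrbitCriterion

set_option linter.dupNamespace false

/-!
# Stub `stub_matrixCriterion` — the matrix criterion (card K3) for `GL_n(F)`-orbit designs

Crux `stmt-MatrixMultiplication-10595` (`Theses.ThinBlockAlpha.ThinPackings`), line `Ideator4Sketch`
(card `automorphism-orbit-twisted-templates`).

For the scaling family `Γ = GL_n(F)` acting on `n × r` matrices by left multiplication, the
`Γ`-twisted clause `MatrixTwistedSumFree` of a template `(A, B, C)` follows from
* (H1) the row-space incidence law in operational form: if a cross sum `g * x + h * y + z`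
  (`x ∈ A − B`, `y ∈ B − C`, `z ∈ C − A`) vanishes for SOME square matrices `g, h`, then already
  `x + y + z = 0`;
* (H2) independence of the `2n` rows of `[x; y]` on trivially-summing pairs, in operational form:
  `x + y ∈ A − C` and `g * x + h * y = 0` force `g = 0` and `h = 0`;
* (H3) the single TPP of the template (`TemplateTPP`).

Proof.  Given `g h : GL_n(F)` with `(g, h) ≠ (1, 1)` and a vanishing twisted cross sum
`g (a' − b) + h (b' − c) + (c' − a) = 0`, (H1) gives `(a' − b) + (b' − c) + (c' − a) = 0`, i.e.
`(a' − a) + (b' − b) + (c' − c) = 0`, so (H3) gives `b = b'` and `x + y = a' − c ∈ A − C`.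
Subtracting, `(g − 1) x + (h − 1) y = 0`, so (H2) gives `g = 1` and `h = 1`, a contradiction.
-/

namespace Summit.MatrixMultiplication.MatrixMultiplication.Theorems.ThinPackings.Orbit

open Finset Matrix
open scoped Pointwise

/-- **Matrix criterion (card K3).**  For `GL_n(F)` acting on `n × r` matrices by left multiplication,
the twisted clause `MatrixTwistedSumFree F n r A B C` follows from the operational row-space incidence
law (H1), the operational independence of the rows of `[x; y]` on trivially-summing pairs (H2), and the
single TPP of the template (H3).  Registered stub `stub_matrixCriterion` of the line's skeleton,
verbatim. [new, elementary] -/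
theorem stub_matrixCriterion : ∀ (F : Type) [Field F] [DecidableEq F] (n r : ℕ) (A B C : Finset (Matrix (Fin n) (Fin r) F)), (∀ x ∈ A - B, ∀ y ∈ B - C, ∀ z ∈ C - A, (∃ g h : Matrix (Fin n) (Fin n) F, g * x + h * y + z = 0) → x + y + z = 0) → (∀ x ∈ A - B, ∀ y ∈ B - C, x + y ∈ A - C → ∀ g h : Matrix (Fin n) (Fin n) F, g * x + h * y = 0 → g = 0 ∧ h = 0) → TemplateTPP A B C → MatrixTwistedSumFree F n r A B C := by
  intro F _ _ n r A B C h1 h2 hT g h hgh a' ha' b hb b' hb' c hc c' hc' a ha hrel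
  -- (H1): the untwisted cross sum vanishes
  have hsum : (a' - b) + (b' - c) + (c' - a) = 0 :=
    h1 _ (sub_mem_sub ha' hb) _ (sub_mem_sub hb' hc) _ (sub_mem_sub hc' ha) ⟨_, _, hrel⟩
  -- (H3): the template elements pair up; we only need `b = b'`
  have hTPP : (a' - a) + (b' - b) + (c' - c) = (a' - b) + (b' - c) + (c' - a) := by abel
  obtain ⟨-, hbb, -⟩ := hT a ha a' ha' b hb b' hb' c hc c' hc' (hTPP.trans hsum)
  -- hence `x + y = a' - c ∈ A - C`
  have hxy : (a' - b) + (b' - c) ∈ A - C := by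
    rw [hbb, sub_add_sub_cancel]
    exact sub_mem_sub ha' hc
  -- (H2) applied to `g - 1`, `h - 1`
  have hker : ((g : Matrix (Fin n) (Fin n) F) - 1) * (a' - b) +
      ((h : Matrix (Fin n) (Fin n) F) - 1) * (b' - c) = 0 := by
    have e : ((g : Matrix (Fin n) (Fin n) F) - 1) * (a' - b) +
        ((h : Matrix (Fin n) (Fin n) F) - 1) * (b' - c) =
        ((g : Matrix (Fin n) (Fin n) F) * (a' - b) + (h : Matrix (Fin n) (Fin n) F) * (b' - c)
          + (c' - a)) - ((a' - b) + (b' - c) + (c' - a)) := by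
      rw [Matrix.sub_mul, Matrix.sub_mul, Matrix.one_mul, Matrix.one_mul]
      abel
    rw [e, hrel, hsum, sub_zero]
  obtain ⟨hg, hh⟩ := h2 _ (sub_mem_sub ha' hb) _ (sub_mem_sub hb' hc) hxy _ _ hker
  rw [sub_eq_zero, Units.val_eq_one] at hg hh
  exact hgh (Prod.ext hg hh)

end Summit.MatrixMultiplication.MatrixMultiplication.Theorems.ThinPackings.Orbit
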